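import Summits.Ventures.PercRepro.ExcessOneComplexTrace
import Summits.Ventures.PercRepro.MSTightLemma

/-!
# Theorem (W1): no crossing covering pair at a tight complex trace of an excess-one family

Setting (proofs/MINE1-theoremS.md, Addendum 24): `F` has `|F \\ F| = |F| + 1`, `{r} ∈ F` and the
trace `P := proj r F` is tight (so `X = P`, `diffsX_eq_proj_of_singleton_mem`). Write
`F₀ = part0 r F`, `F₁ = partr r F`, `Y = diffsY r F`. A member `x ∈ F₀` without its `r`-partner
(`x ∉ F₁`) never lies directly below an `r`-only member: there is no `b ∉ x` with
`insert b x ∈ F₁ \ F₀`.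

The proof is the trace identity at the element `b`: with
`lk := {e ∈ P : b ∉ e, insert b e ∈ P}`, `L₀ := {s ∈ F₀ : b ∉ s, insert b s ∈ F₀}`,
`L₁ := {t ∈ F₁ : b ∉ t, insert b t ∈ F₁}`, `L := L₀ ∩ L₁` and
`Λ := {y ∈ Y : b ∉ y, insert b y ∈ Y}` one has
`|lk| + |Λ| ≤ |diffsX b F ∩ diffsY b F| ≤ |partner b F| + 1 ≤ |L₀| + |L₁| + 1` and
`|lk| ≥ |L₀ ∪ L₁| + 1` (the pair `(x, insert b x)` is in `lk` but in neither `L₀` nor `L₁`),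
hence `|Λ| ≤ |L|`; and `Λ ⊇ L \\ L`, so `L` is tight and `Λ = L \\ L` (nonempty, as `∅ ∈ Λ`).
Then every `x \ ℓ` and `ℓ \ x` (`ℓ ∈ L`) lies in `Λ = L \\ L`, Lemma 3 of MSTightLemma (both forms)
sandwiches `x` between two members of `L`, and convexity of tight families on twin-closed sets
(`mem_of_subset_of_subset_of_twinClosed_of_tight`) puts `x ∈ L ⊆ F₁` — a contradiction.
-/

namespace PercRepro.MSTight

open Finset
open scoped FinsetFamily

variable {α : Type*} [DecidableEq α] [Fintype α]

section NoCrossingPair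

variable {F : Finset (Finset α)} {r b : α}

omit [Fintype α] in
/-- The trace identity at `b`, as an inequality: `|X_b ∩ Y_b| ≤ |partner b F| + 1` when
`|F \\ F| = |F| + 1`. -/
theorem card_diffsX_inter_diffsY_le_of_card_diffs_eq (b : α)
    (hF : (F \\ F).card = F.card + 1) :
    (diffsX b F ∩ diffsY b F).card ≤ (partner b F).card + 1 := by
  have h1 := card_diffs_eq_card_diffs_proj_add b F
  have h2 := card_eq_card_proj_add_card_partner b F
  have h3 := Finset.card_le_card_diffs (proj b F)
  omega

omit [Fintype α] in
/-- Members of the trace avoid `r`. -/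
theorem notMem_of_mem_proj' {e : Finset α} (he : e ∈ proj r F) : r ∉ e := by
  obtain ⟨B, _, rfl⟩ := mem_proj.1 he
  exact notMem_erase r B

omit [Fintype α] in
/-- Lower bound for `|X_b ∩ Y_b|`: the `b`-pairs of the trace and the `b`-pairs of `Y` inject
into it, when `X = P`. -/
theorem card_lk_add_card_lam_le (hbr : b ≠ r) (hX : diffsX r F = proj r F) :
    ((proj r F).filter fun e => b ∉ e ∧ insert b e ∈ proj r F).card +
      ((diffsY r F).filter fun y => b ∉ y ∧ insert b y ∈ diffsY r F).card ≤
      (diffsX b F ∩ diffsY b F).card := by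
  set lk := (proj r F).filter fun e => b ∉ e ∧ insert b e ∈ proj r F with hlk
  set lam := (diffsY r F).filter fun y => b ∉ y ∧ insert b y ∈ diffsY r F with hlam
  -- every member of the trace is a difference avoiding `r`
  have hPD : ∀ e ∈ proj r F, e ∈ F \\ F := fun e he => by
    rw [← hX] at he; exact (mem_diffsX_iff.1 he).1
  have h1 : lk ⊆ diffsX b F ∩ diffsY b F := by
    intro e he
    rw [hlk, mem_filter] at he
    obtain ⟨heP, hbe, hbeP⟩ := he
    refine mem_inter.2 ⟨mem_diffsX_iff.2 ⟨hPD e heP, hbe⟩, mem_diffsY_iff.2 ⟨hbe, hPD _ hbeP⟩⟩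
  have h2 : lam.image (insert r) ⊆ diffsX b F ∩ diffsY b F := by
    intro e he
    obtain ⟨y, hy, rfl⟩ := mem_image.1 he
    rw [hlam, mem_filter] at hy
    obtain ⟨hyY, hby, hbyY⟩ := hy
    have hyD := (mem_diffsY_iff.1 hyY).2
    have hbyD := (mem_diffsY_iff.1 hbyY).2
    refine mem_inter.2 ⟨mem_diffsX_iff.2 ⟨hyD, ?_⟩, mem_diffsY_iff.2 ⟨?_, ?_⟩⟩
    · rw [mem_insert]; rintro (h | h); exact hbr h; exact hby h
    · rw [mem_insert]; rintro (h | h); exact hbr h; exact hby h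
    · rw [Finset.insert_comm]; exact hbyD
  have hdisj : Disjoint lk (lam.image (insert r)) := by
    rw [Finset.disjoint_left]
    intro e he he'
    obtain ⟨y, _, rfl⟩ := mem_image.1 he'
    rw [hlk, mem_filter] at he
    exact notMem_of_mem_proj' he.1 (mem_insert_self r y)
  have hinj : (lam.image (insert r)).card = lam.card := by
    apply card_image_of_injOn
    intro y hy y' hy' h
    have hry : r ∉ y := (mem_diffsY_iff.1 (mem_filter.1 hy).1).1
    have hry' : r ∉ y' := (mem_diffsY_iff.1 (mem_filter.1 hy').1).1
    have h' : insert r y = insert r y' := h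
    rw [← erase_insert hry, ← erase_insert hry', h']
  calc lk.card + lam.card = (lk ∪ lam.image (insert r)).card := by
        rw [card_union_of_disjoint hdisj, hinj]
    _ ≤ (diffsX b F ∩ diffsY b F).card := card_le_card (union_subset h1 h2)

omit [Fintype α] in
/-- The `b`-partner family is covered by the `b`-pairs of `F₀` and the lifted `b`-pairs of `F₁`. -/
theorem card_partner_le_card_L0_add_card_L1 (hbr : b ≠ r) :
    (partner b F).card ≤ ((part0 r F).filter fun s => b ∉ s ∧ insert b s ∈ part0 r F).card +
      ((partr r F).filter fun t => b ∉ t ∧ insert b t ∈ partr r F).card := by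
  set L0 := (part0 r F).filter fun s => b ∉ s ∧ insert b s ∈ part0 r F with hL0
  set L1 := (partr r F).filter fun t => b ∉ t ∧ insert b t ∈ partr r F with hL1
  have hsub : partner b F ⊆ L0 ∪ L1.image (insert r) := by
    intro v hv
    have hv0 := mem_part0.1 (mem_inter.1 hv).1
    have hv1 := mem_partr.1 (mem_inter.1 hv).2
    by_cases hrv : r ∈ v
    · apply mem_union_right
      refine mem_image.2 ⟨v.erase r, ?_, insert_erase hrv⟩
      rw [hL1, mem_filter, mem_partr, mem_partr]
      refine ⟨⟨notMem_erase r v, by rw [insert_erase hrv]; exact hv0.1⟩, ?_, ?_, ?_⟩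
      · exact fun h => hv1.1 (mem_of_mem_erase h)
      · rw [mem_insert]; rintro (h | h); exact hbr h.symm; exact notMem_erase r v h
      · rw [Finset.insert_comm, insert_erase hrv]; exact hv1.2
    · apply mem_union_left
      rw [hL0, mem_filter, mem_part0, mem_part0]
      refine ⟨⟨hv0.1, hrv⟩, hv1.1, hv1.2, ?_⟩
      rw [mem_insert]; rintro (h | h); exact hbr h.symm; exact hrv h
  calc (partner b F).card ≤ (L0 ∪ L1.image (insert r)).card := card_le_card hsub
    _ ≤ L0.card + (L1.image (insert r)).card := card_union_le _ _
    _ ≤ L0.card + L1.card := by have := card_image_le (s := L1) (f := insert r); omega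

omit [Fintype α] in
/-- `insert b x \ insert b ℓ = x \ ℓ` when `b ∉ x`. -/
theorem insert_sdiff_insert_of_notMem {x ℓ : Finset α} (hbx : b ∉ x) :
    insert b x \ insert b ℓ = x \ ℓ := by
  rw [Finset.insert_sdiff_insert, Finset.sdiff_insert_of_notMem hbx]

/-- **Theorem (W1).** At a tight trace with `{r} ∈ F` of a family of excess one, a member `x`
avoiding `r` without its `r`-partner has no cover `insert b x` that is an `r`-only member. -/
theorem not_insert_mem_partr_sdiff_part0 (hF : (F \\ F).card = F.card + 1)
    (hP : Tight (proj r F)) (hr : ({r} : Finset α) ∈ F) {x : Finset α}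
    (hx0 : x ∈ part0 r F) (hx1 : x ∉ partr r F) (hbx : b ∉ x)
    (hxb1 : insert b x ∈ partr r F) (hxb0 : insert b x ∉ part0 r F) : False := by
  have hbr : b ≠ r := by
    rintro rfl
    exact (mem_partr.1 hxb1).1 (mem_insert_self b x)
  have hX : diffsX r F = proj r F := diffsX_eq_proj_of_singleton_mem hP hr
  -- the four families
  set lk := (proj r F).filter fun e => b ∉ e ∧ insert b e ∈ proj r F with hlk
  set lam := (diffsY r F).filter fun y => b ∉ y ∧ insert b y ∈ diffsY r F with hlam
  set L0 := (part0 r F).filter fun s => b ∉ s ∧ insert b s ∈ part0 r F with hL0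
  set L1 := (partr r F).filter fun t => b ∉ t ∧ insert b t ∈ partr r F with hL1
  set L := L0 ∩ L1 with hL
  -- (1)–(2): |Λ| ≤ |L|
  have hA : lk.card + lam.card ≤ (diffsX b F ∩ diffsY b F).card := card_lk_add_card_lam_le hbr hX
  have hB : (diffsX b F ∩ diffsY b F).card ≤ (partner b F).card + 1 :=
    card_diffsX_inter_diffsY_le_of_card_diffs_eq b hF
  have hC : (partner b F).card ≤ L0.card + L1.card := card_partner_le_card_L0_add_card_L1 hbr
  have hD : (L0 ∪ L1).card + 1 ≤ lk.card := by
    have hx_lk : x ∈ lk := by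
      rw [hlk, mem_filter, proj_eq_union]
      exact ⟨mem_union_left _ hx0, hbx, mem_union_right _ hxb1⟩
    have hx_not : x ∉ L0 ∪ L1 := by
      rw [mem_union, hL0, hL1, mem_filter, mem_filter]
      rintro (⟨_, _, h⟩ | ⟨h, _⟩)
      · exact hxb0 h
      · exact hx1 h
    have hsub : insert x (L0 ∪ L1) ⊆ lk := by
      apply insert_subset hx_lk
      apply union_subset
      · intro s hs
        rw [hL0, mem_filter] at hs
        rw [hlk, mem_filter, proj_eq_union]
        exact ⟨mem_union_left _ hs.1, hs.2.1, mem_union_left _ hs.2.2⟩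
      · intro t ht
        rw [hL1, mem_filter] at ht
        rw [hlk, mem_filter, proj_eq_union]
        exact ⟨mem_union_right _ ht.1, ht.2.1, mem_union_right _ ht.2.2⟩
    calc (L0 ∪ L1).card + 1 = (insert x (L0 ∪ L1)).card := (card_insert_of_notMem hx_not).symm
      _ ≤ lk.card := card_le_card hsub
  have hE : (L0 ∪ L1).card + L.card = L0.card + L1.card := card_union_add_card_inter L0 L1
  have hlamL : lam.card ≤ L.card := by omega
  -- (3): L \\ L ⊆ Λ, so L is tight and Λ = L \\ L
  have hLL : L \\ L ⊆ lam := by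
    intro d hd
    obtain ⟨ℓ, hℓ, ℓ', hℓ', rfl⟩ := Finset.mem_diffs.1 hd
    rw [hL, mem_inter, hL0, hL1, mem_filter, mem_filter] at hℓ hℓ'
    rw [hlam, mem_filter]
    refine ⟨sdiff_mem_diffs hℓ.2.1 hℓ'.1.1, fun h => hℓ.1.2.1 (mem_sdiff.1 h).1, ?_⟩
    rw [← Finset.insert_sdiff_of_notMem ℓ hℓ'.1.2.1]
    exact sdiff_mem_diffs hℓ.2.2.2 hℓ'.1.1
  have hMS : L.card ≤ (L \\ L).card := Finset.card_le_card_diffs L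
  have hcardLL : (L \\ L).card = L.card := by
    have := card_le_card hLL; omega
  have hLt : Tight L := hcardLL
  have hlamEq : lam = L \\ L := by
    symm; apply eq_of_subset_of_card_le hLL; omega
  -- ∅ ∈ Λ, hence L is nonempty
  have h0Y : (∅ : Finset α) ∈ partr r F := mem_partr.2 ⟨notMem_empty r, by simpa using hr⟩
  have hne : L.Nonempty := by
    have h0 : (∅ : Finset α) ∈ lam := by
      rw [hlam, mem_filter]
      refine ⟨?_, notMem_empty b, ?_⟩
      · have h := sdiff_mem_diffs h0Y hx0
        rw [Finset.empty_sdiff] at h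
        exact h
      · have : insert b x \ x = insert b (∅ : Finset α) := by
          rw [Finset.insert_sdiff_of_notMem x hbx, sdiff_self]; rfl
        rw [← this]; exact sdiff_mem_diffs hxb1 hx0
    rw [hlamEq] at h0
    exact Finset.Nonempty.of_diffs_left ⟨∅, h0⟩
  -- (4): the differences of `x` with `L` lie in `L \\ L`
  have hxL : ∀ ℓ ∈ L, x \ ℓ ∈ L \\ L := by
    intro ℓ hℓ
    rw [hL, mem_inter, hL0, hL1, mem_filter, mem_filter] at hℓ
    rw [← hlamEq, hlam, mem_filter]
    refine ⟨?_, fun h => hbx (mem_sdiff.1 h).1, ?_⟩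
    · rw [← insert_sdiff_insert_of_notMem hbx]
      exact sdiff_mem_diffs hxb1 hℓ.1.2.2
    · rw [← Finset.insert_sdiff_of_notMem x hℓ.1.2.1]
      exact sdiff_mem_diffs hxb1 hℓ.1.1
  have hLx : ∀ ℓ ∈ L, ℓ \ x ∈ L \\ L := by
    intro ℓ hℓ
    rw [hL, mem_inter, hL0, hL1, mem_filter, mem_filter] at hℓ
    rw [← hlamEq, hlam, mem_filter]
    refine ⟨sdiff_mem_diffs hℓ.2.1 hx0, fun h => hℓ.1.2.1 (mem_sdiff.1 h).1, ?_⟩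
    rw [← Finset.insert_sdiff_of_notMem ℓ hbx]
    exact sdiff_mem_diffs hℓ.2.2.2 hx0
  -- Lemma 3, both forms: `ℓ₁ ⊆ x ⊆ ℓ₀`
  obtain ⟨ℓ₀, hℓ₀, hxℓ₀⟩ := subset_of_diffs_mem univ L x (fun E _ => subset_univ E)
    (subset_univ x) hne hLt hxL
  obtain ⟨ℓ₁, hℓ₁, hℓ₁x⟩ := exists_subset_of_sdiff_mem univ L x (fun E _ => subset_univ E)
    (subset_univ x) hne hLt hLx
  -- convexity: `x ∈ L ⊆ F₁`
  have hTC : TwinClosed L x := by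
    have hx_eq : ℓ₁ ∪ x \ ℓ₁ = x := union_sdiff_of_subset hℓ₁x
    rw [← hx_eq]
    exact (twinClosed_of_mem hℓ₁).union (twinClosed_of_mem_diffs (hxL ℓ₁ hℓ₁))
  have hxmem : x ∈ L := mem_of_subset_of_subset_of_twinClosed_of_tight hLt hℓ₁ hℓ₀ hℓ₁x hxℓ₀ hTC
  exact hx1 (mem_filter.1 (mem_inter.1 hxmem).2).1

end NoCrossingPair

end PercRepro.MSTight
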